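import Literature.Probability.Percolation.StoppingSetCondExp
import HarnessLib

/-!
# The final estimates of Schramm–Smirnov's mesh-independent gluing (Prop. 4.1): the `L²` bookkeeping

Topic `Literature/Probability/Percolation`; proofs-only support file (no definition, no named
fact) for Proposition 4.1 of O. Schramm, S. Smirnov, *On the scaling limits of planar
percolation*, Ann. Probab. 39 (2011), arXiv:1101.5820, §4, "Final estimates" (p. 20):

> "`‖Ỹ_T - Ỹ‖₂ < √(2ε₀)` (4.6) … By (4.2) and the definition of `Y_s`, we can write
> `‖Y₀ - Y_s‖₂² < 2ε₀ + ε₀² < 3ε₀`, and by (4.4), we have `‖Y₀ - Ỹ₀‖₂ < √ε₀` (4.7).  Hence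
> `‖Ỹ₀ - Y_s‖₂ < √(3ε₀) + √ε₀ < 3√ε₀`.  Since `Y_s` is `𝓕_s`-measurable, it is also
> `ω|_M`-measurable.  By its definition, `Ỹ` minimizes `‖Ỹ₀ - X‖₂²` among `ω|_M`-measurable random
> variables `X`.  Therefore, comparison to `Y_s` (recall that the set `M` includes the complement
> of the `s`-neighborhood of `α`) yields `‖Ỹ₀ - Ỹ‖₂ ≤ ‖Ỹ₀ - Y_s‖₂ < 3√ε₀`.  Combining this with
> (4.6) and (4.7), we conclude that `‖Y₀ - Ỹ_T‖₂ < 6√ε₀`.  Because `Ỹ_T` is `𝓕_T`-measurable and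
> `ε₀` may be chosen arbitrarily small, this proves that there is an `𝓕_T`-measurable event `𝒲`
> (which may depend on `η`), such that `P_η(𝒲 Δ ⊞_{Q₀}) < ε/2`."

This file is exactly that paragraph, for Bernoulli bond percolation on an arbitrary countable
graph, with every ingredient an explicit hypothesis (they are the outputs of the other steps of
the proof: (4.4) = `QuadCrossingExcision.lean`, (4.2) = the discrete gluing theorem
`QuadCrossingDiscreteGluingGarban.lean`, the stopping set `M` and `Ỹ = P(E' | ω|_M)` =
`SeededExplorer.lean` + `StoppingSetCondExp.lean`, (4.6) = the coarse-graining steps):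

* `measureReal_symmDiff_setOf_lt_le` — **event extraction**: for an event `E` and a real function
  `Z`, `P(({Z > 1/2}) Δ E) ≤ 4 ∫ (𝟙_E - Z)²` (on the symmetric difference `|𝟙_E - Z| ≥ 1/2`);
* `integral_sq_sub_le_three` — the square-root-free triangle inequality
  `∫(f-h)² ≤ 3(∫(f-g)² + ∫(g-k)² + ∫(k-h)²)`;
* `gluing_final_estimates` — **the final estimates**: if `P(E Δ E') ≤ ε₀` ((4.4)),
  `∫(𝟙_E - Y_s)² ≤ a` with `Y_s = P(E | ω off B)` ((4.2) in `L²` form), the stopping set `N`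
  (window `G₀`) always contains the edges off the block `B` (`G₀ ∖ N(ω) ⊆ B`: "`M` includes the
  complement of the `s`-neighborhood"), and `Z` is any measurable function with `|Z| ≤ 1` and
  `∫(Z - Ỹ)² ≤ b` for `Ỹ = stoppedCondProb G₀ N E'` ((4.6) with `Z = Ỹ_T`), then
  `P({Z > 1/2} Δ E) ≤ 12 (3ε₀ + 2a + b)`.  When `Z` is measurable for a sub-σ-algebra `𝓕_T`, so is
  the event `{Z > 1/2}` (`measurableSet_setOf_lt_of_measurable`), which is the `𝒲` of the source.

## References

* O. Schramm, S. Smirnov, Ann. Probab. 39 (2011) 1768–1814, arXiv:1101.5820, §4, proof of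
  Prop. 4.1, "Final estimates" (eqs. (4.2), (4.4), (4.6), (4.7)). [SchrammSmirnov2011]

Tree: `stoppedCondProb`, `integral_sq_indicator_sub_stoppedCondProb_le_blockCondProb`,
`measurable_stoppedCondProb`, `abs_stoppedCondProb_le` (`StoppingSetCondExp.lean`), `blockCondProb`,
`measurable_blockCondProb`, `abs_blockCondProb_le`, `abs_indicator_one_le` (`BlockResampling.lean`),
`IsStoppingSet` (`ColourSwitching.lean`).  Mathlib: `integral_mono`, `integral_add`,
`abs_measureReal_sub_le_measureReal_symmDiff`.
-/

noncomputable section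

open MeasureTheory ProbabilityTheory Set
open scoped symmDiff

namespace Literature.Probability.Percolation

/-! ### Event extraction from an `L²` approximation -/

section Extraction

variable {Ω : Type*} [MeasurableSpace Ω] (P : Measure Ω) [IsProbabilityMeasure P]

omit [MeasurableSpace Ω] in
/-- `|𝟙_E| ≤ 1`. [folklore] -/
theorem abs_indicator_one_le_one (E : Set Ω) (ω : Ω) : |E.indicator (1 : Ω → ℝ) ω| ≤ 1 := by
  by_cases h : ω ∈ E
  · rw [Set.indicator_of_mem h, Pi.one_apply, abs_one]
  · rw [Set.indicator_of_notMem h, abs_zero]; exact zero_le_one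

/-- **Event extraction**: `P({Z > 1/2} Δ E) ≤ 4 ∫ (𝟙_E - Z)²` for a measurable event `E` and a
measurable `Z` with `|Z| ≤ 1` — on the symmetric difference `|𝟙_E - Z| ≥ 1/2` ("there is an
`𝓕_T`-measurable event `𝒲` such that `P(𝒲 Δ ⊞_{Q₀}) < ε/2`"). [cite: SchrammSmirnov2011, §4, proof of Prop. 4.1 ("Final estimates", the event 𝒲)] -/
theorem measureReal_symmDiff_setOf_lt_le {E : Set Ω} (hE : MeasurableSet E) {Z : Ω → ℝ}
    (hZm : Measurable Z) (hZ1 : ∀ ω, |Z ω| ≤ 1) :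
    P.real ({ω | 1 / 2 < Z ω} ∆ E) ≤ 4 * ∫ ω, (E.indicator (1 : Ω → ℝ) ω - Z ω) ^ 2 ∂P := by
  have hWm : MeasurableSet {ω | 1 / 2 < Z ω} := measurableSet_lt measurable_const hZm
  have hSm : MeasurableSet ({ω | 1 / 2 < Z ω} ∆ E) := hWm.symmDiff hE
  have hpt : ∀ ω, ({ω | 1 / 2 < Z ω} ∆ E).indicator (1 : Ω → ℝ) ω ≤
      4 * (E.indicator (1 : Ω → ℝ) ω - Z ω) ^ 2 := by
    intro ω
    by_cases hω : ω ∈ {ω | 1 / 2 < Z ω} ∆ E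
    · rw [Set.indicator_of_mem hω, Pi.one_apply]
      rw [Set.mem_symmDiff, mem_setOf_eq] at hω
      rcases hω with ⟨h1, h2⟩ | ⟨h1, h2⟩
      · rw [Set.indicator_of_notMem h2]; nlinarith
      · rw [Set.indicator_of_mem h1, Pi.one_apply]
        nlinarith [not_lt.1 h2]
    · rw [Set.indicator_of_notMem hω]; positivity
  have hint : Integrable (fun ω => 4 * (E.indicator (1 : Ω → ℝ) ω - Z ω) ^ 2) P := by
    refine (Integrable.of_bound (((measurable_one.indicator hE).sub hZm).pow_const 2).aestronglyMeasurable
      ((1 + 1) ^ 2) (ae_of_all _ fun ω => ?_)).const_mul 4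
    rw [Real.norm_eq_abs, abs_pow]
    exact pow_le_pow_left₀ (abs_nonneg _) ((abs_sub _ _).trans (add_le_add (abs_indicator_one_le_one E ω) (hZ1 ω))) 2
  calc P.real ({ω | 1 / 2 < Z ω} ∆ E)
      = ∫ ω, ({ω | 1 / 2 < Z ω} ∆ E).indicator (1 : Ω → ℝ) ω ∂P := (integral_indicator_one hSm).symm
    _ ≤ ∫ ω, 4 * (E.indicator (1 : Ω → ℝ) ω - Z ω) ^ 2 ∂P :=
        integral_mono ((integrable_const (1 : ℝ)).indicator hSm) hint hpt
    _ = 4 * ∫ ω, (E.indicator (1 : Ω → ℝ) ω - Z ω) ^ 2 ∂P := integral_const_mul _ _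

omit [MeasurableSpace Ω] in
/-- If `Z` is measurable for a sub-σ-algebra then so is the extracted event `{Z > 1/2}`.
[folklore] -/
theorem measurableSet_setOf_lt_of_measurable {m : MeasurableSpace Ω} {Z : Ω → ℝ}
    (hZ : Measurable[m] Z) : MeasurableSet[m] {ω | (1 : ℝ) / 2 < Z ω} :=
  measurableSet_lt (measurable_const (a := (1 : ℝ) / 2)) hZ

/-- **Square-root-free triangle inequality**: `∫(f-h)² ≤ 3(∫(f-g)² + ∫(g-k)² + ∫(k-h)²)` for
bounded measurable real functions. [folklore] -/
theorem integral_sq_sub_le_three {f g k h : Ω → ℝ} (hfm : Measurable f) (hgm : Measurable g)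
    (hkm : Measurable k) (hhm : Measurable h) {C : ℝ} (hf : ∀ ω, |f ω| ≤ C) (hg : ∀ ω, |g ω| ≤ C)
    (hk : ∀ ω, |k ω| ≤ C) (hh : ∀ ω, |h ω| ≤ C) :
    ∫ ω, (f ω - h ω) ^ 2 ∂P ≤
      3 * (∫ ω, (f ω - g ω) ^ 2 ∂P + ∫ ω, (g ω - k ω) ^ 2 ∂P + ∫ ω, (k ω - h ω) ^ 2 ∂P) := by
  have hb : ∀ {u v : Ω → ℝ}, Measurable u → Measurable v → (∀ ω, |u ω| ≤ C) → (∀ ω, |v ω| ≤ C) →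
      Integrable (fun ω => (u ω - v ω) ^ 2) P := by
    intro u v hum hvm hu hv
    refine Integrable.of_bound ((hum.sub hvm).pow_const 2).aestronglyMeasurable ((C + C) ^ 2)
      (ae_of_all _ fun ω => ?_)
    rw [Real.norm_eq_abs, abs_pow]
    exact pow_le_pow_left₀ (abs_nonneg _) ((abs_sub _ _).trans (add_le_add (hu ω) (hv ω))) 2
  have hpt : ∀ ω, (f ω - h ω) ^ 2 ≤ 3 * ((f ω - g ω) ^ 2 + (g ω - k ω) ^ 2 + (k ω - h ω) ^ 2) := by
    intro ω
    nlinarith [sq_nonneg (f ω - g ω - (g ω - k ω)), sq_nonneg (g ω - k ω - (k ω - h ω)),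
      sq_nonneg (f ω - g ω - (k ω - h ω))]
  have h12 : Integrable (fun ω => (f ω - g ω) ^ 2 + (g ω - k ω) ^ 2) P :=
    (hb hfm hgm hf hg).add (hb hgm hkm hg hk)
  have h123 : Integrable (fun ω => (f ω - g ω) ^ 2 + (g ω - k ω) ^ 2 + (k ω - h ω) ^ 2) P :=
    h12.add (hb hkm hhm hk hh)
  calc ∫ ω, (f ω - h ω) ^ 2 ∂P ≤ ∫ ω, 3 * ((f ω - g ω) ^ 2 + (g ω - k ω) ^ 2 + (k ω - h ω) ^ 2) ∂P :=
        integral_mono (hb hfm hhm hf hh) (h123.const_mul 3) hpt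
    _ = 3 * (∫ ω, (f ω - g ω) ^ 2 ∂P + ∫ ω, (g ω - k ω) ^ 2 ∂P + ∫ ω, (k ω - h ω) ^ 2 ∂P) := by
        rw [integral_const_mul, integral_add h12 (hb hkm hhm hk hh), integral_add (hb hfm hgm hf hg) (hb hgm hkm hg hk)]

/-- `∫(f-h)² ≤ 2(∫(f-g)² + ∫(g-h)²)`. [folklore] -/
theorem integral_sq_sub_le_two {f g h : Ω → ℝ} (hfm : Measurable f) (hgm : Measurable g)
    (hhm : Measurable h) {C : ℝ} (hf : ∀ ω, |f ω| ≤ C) (hg : ∀ ω, |g ω| ≤ C) (hh : ∀ ω, |h ω| ≤ C) :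
    ∫ ω, (f ω - h ω) ^ 2 ∂P ≤ 2 * (∫ ω, (f ω - g ω) ^ 2 ∂P + ∫ ω, (g ω - h ω) ^ 2 ∂P) := by
  have hb : ∀ {u v : Ω → ℝ}, Measurable u → Measurable v → (∀ ω, |u ω| ≤ C) → (∀ ω, |v ω| ≤ C) →
      Integrable (fun ω => (u ω - v ω) ^ 2) P := by
    intro u v hum hvm hu hv
    refine Integrable.of_bound ((hum.sub hvm).pow_const 2).aestronglyMeasurable ((C + C) ^ 2)
      (ae_of_all _ fun ω => ?_)
    rw [Real.norm_eq_abs, abs_pow]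
    exact pow_le_pow_left₀ (abs_nonneg _) ((abs_sub _ _).trans (add_le_add (hu ω) (hv ω))) 2
  have hpt : ∀ ω, (f ω - h ω) ^ 2 ≤ 2 * ((f ω - g ω) ^ 2 + (g ω - h ω) ^ 2) := by
    intro ω
    nlinarith [sq_nonneg (f ω - g ω - (g ω - h ω))]
  have h12 : Integrable (fun ω => (f ω - g ω) ^ 2 + (g ω - h ω) ^ 2) P :=
    (hb hfm hgm hf hg).add (hb hgm hhm hg hh)
  calc ∫ ω, (f ω - h ω) ^ 2 ∂P ≤ ∫ ω, 2 * ((f ω - g ω) ^ 2 + (g ω - h ω) ^ 2) ∂P :=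
        integral_mono (hb hfm hhm hf hh) (h12.const_mul 2) hpt
    _ = 2 * (∫ ω, (f ω - g ω) ^ 2 ∂P + ∫ ω, (g ω - h ω) ^ 2 ∂P) := by
        rw [integral_const_mul, integral_add (hb hfm hgm hf hg) (hb hgm hhm hg hh)]

omit [IsProbabilityMeasure P] in
/-- `∫ (𝟙_E - 𝟙_{E'})² = P(E Δ E')`. [folklore] -/
theorem integral_sq_indicator_sub_indicator {E E' : Set Ω} (hE : MeasurableSet E)
    (hE' : MeasurableSet E') :
    ∫ ω, (E.indicator (1 : Ω → ℝ) ω - E'.indicator (1 : Ω → ℝ) ω) ^ 2 ∂P = P.real (E ∆ E') := by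
  rw [← integral_indicator_one (hE.symmDiff hE')]
  refine integral_congr_ae (ae_of_all _ fun ω => ?_)
  show (E.indicator (1 : Ω → ℝ) ω - E'.indicator (1 : Ω → ℝ) ω) ^ 2 = (E ∆ E').indicator (1 : Ω → ℝ) ω
  by_cases h1 : ω ∈ E <;> by_cases h2 : ω ∈ E'
  · rw [Set.indicator_of_mem h1, Set.indicator_of_mem h2,
      Set.indicator_of_notMem (by rw [Set.mem_symmDiff]; tauto)]
    simp
  · rw [Set.indicator_of_mem h1, Set.indicator_of_notMem h2,
      Set.indicator_of_mem (by rw [Set.mem_symmDiff]; tauto)]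
    simp
  · rw [Set.indicator_of_notMem h1, Set.indicator_of_mem h2,
      Set.indicator_of_mem (by rw [Set.mem_symmDiff]; tauto)]
    simp
  · rw [Set.indicator_of_notMem h1, Set.indicator_of_notMem h2,
      Set.indicator_of_notMem (by rw [Set.mem_symmDiff]; tauto)]
    simp

end Extraction

/-! ### The final estimates -/

section Final

variable {V : Type*} [DecidableEq V] [Countable V] (G : SimpleGraph V) (p : unitInterval)

/-- **Schramm–Smirnov's final estimates** (bond percolation on any countable graph, any parameter).
Let `E` (`⊞_{Q₀}`) and `E'` (`{ω̃ ∈ ⊞_{Q₀}}`) be measurable events with `P_p(E Δ E') ≤ ε₀`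
((4.4)); `B` a block with `∫(𝟙_E - P_p(E | ω off B))² ≤ a` ((4.2), the discrete gluing in `L²`
form); `N` a stopping set in the window `G₀` whose unexplored block `G₀ ∖ N(ω)` always lies in `B`
("the set `M` includes the complement of the `s`-neighborhood of `α`"), `Ỹ = P_p(E' | explored
data)`; and `Z` any measurable function with `|Z| ≤ 1` and `∫(Z - Ỹ)² ≤ b` ((4.6), `Z = Ỹ_T`).
Then the event `𝒲 = {Z > 1/2}` satisfies `P_p(𝒲 Δ E) ≤ 12 (3ε₀ + 2a + b)` — the chain
`‖Y₀ - Z‖₂ ≤ ‖Y₀ - Ỹ₀‖₂ + ‖Ỹ₀ - Ỹ‖₂ + ‖Ỹ - Z‖₂`, `‖Ỹ₀ - Ỹ‖₂ ≤ ‖Ỹ₀ - Y_s‖₂ ≤ ‖Ỹ₀ - Y₀‖₂ + ‖Y₀ - Y_s‖₂`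
without square roots. [cite: SchrammSmirnov2011, §4, proof of Prop. 4.1 ("Final estimates")] -/
theorem gluing_final_estimates {G₀ : Finset (Sym2 V)} {N : BondConfig V → Finset (Sym2 V)}
    (hN : IsStoppingSet N) (hNG : ∀ ω, N ω ⊆ G₀) {B : Finset (Sym2 V)} (hB : ∀ ω, G₀ \ N ω ⊆ B)
    {E E' : Set (BondConfig V)} (hE : MeasurableSet E) (hE' : MeasurableSet E')
    {ε₀ a b : ℝ} (h44 : (bondPercolation G p).real (E ∆ E') ≤ ε₀)
    (h42 : ∫ ω, (E.indicator (1 : BondConfig V → ℝ) ω - blockCondProb G p B E ω) ^ 2 ∂(bondPercolation G p) ≤ a)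
    {Z : BondConfig V → ℝ} (hZm : Measurable Z) (hZ1 : ∀ ω, |Z ω| ≤ 1)
    (h46 : ∫ ω, (Z ω - stoppedCondProb G p G₀ N E' ω) ^ 2 ∂(bondPercolation G p) ≤ b) :
    (bondPercolation G p).real ({ω | 1 / 2 < Z ω} ∆ E) ≤ 12 * (3 * ε₀ + 2 * a + b) := by
  set P := bondPercolation G p with hP
  set Y₀ := E.indicator (1 : BondConfig V → ℝ) with hY₀
  set Y₀' := E'.indicator (1 : BondConfig V → ℝ) with hY₀'
  set Ys := blockCondProb G p B E with hYs
  set Yt := stoppedCondProb G p G₀ N E' with hYt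
  have hY₀m : Measurable Y₀ := measurable_one.indicator hE
  have hY₀'m : Measurable Y₀' := measurable_one.indicator hE'
  have hYsm : Measurable Ys := measurable_blockCondProb G p B hE
  have hYtm : Measurable Yt := measurable_stoppedCondProb G p hN hNG hE'
  have hY₀1 : ∀ ω, |Y₀ ω| ≤ 1 := abs_indicator_one_le E
  have hY₀'1 : ∀ ω, |Y₀' ω| ≤ 1 := abs_indicator_one_le E'
  have hYs1 : ∀ ω, |Ys ω| ≤ 1 := abs_blockCondProb_le G p B E
  have hYt1 : ∀ ω, |Yt ω| ≤ 1 := abs_stoppedCondProb_le G p E'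
  -- (4.7): `‖Y₀ - Ỹ₀‖₂² = P(E Δ E') ≤ ε₀`
  have h47 : ∫ ω, (Y₀ ω - Y₀' ω) ^ 2 ∂P ≤ ε₀ := by
    rw [hY₀, hY₀', integral_sq_indicator_sub_indicator P hE hE']; exact h44
  have h47' : ∫ ω, (Y₀' ω - Y₀ ω) ^ 2 ∂P ≤ ε₀ := by
    have : ∫ ω, (Y₀' ω - Y₀ ω) ^ 2 ∂P = ∫ ω, (Y₀ ω - Y₀' ω) ^ 2 ∂P :=
      integral_congr_ae (ae_of_all _ fun ω => by ring)
    rw [this]; exact h47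
  -- minimality: `‖Ỹ₀ - Ỹ‖₂² ≤ ‖Ỹ₀ - Y_s‖₂² ≤ 2(‖Ỹ₀ - Y₀‖₂² + ‖Y₀ - Y_s‖₂²)`
  have hmin : ∫ ω, (Y₀' ω - Yt ω) ^ 2 ∂P ≤ 2 * (ε₀ + a) := by
    calc ∫ ω, (Y₀' ω - Yt ω) ^ 2 ∂P ≤ ∫ ω, (Y₀' ω - Ys ω) ^ 2 ∂P :=
          integral_sq_indicator_sub_stoppedCondProb_le_blockCondProb G p hN hNG hE' B hB hE
      _ ≤ 2 * (∫ ω, (Y₀' ω - Y₀ ω) ^ 2 ∂P + ∫ ω, (Y₀ ω - Ys ω) ^ 2 ∂P) :=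
          integral_sq_sub_le_two P hY₀'m hY₀m hYsm hY₀'1 hY₀1 hYs1
      _ ≤ 2 * (ε₀ + a) := by nlinarith [h47', h42]
  -- (4.6), reversed
  have h46' : ∫ ω, (Yt ω - Z ω) ^ 2 ∂P ≤ b := by
    have : ∫ ω, (Yt ω - Z ω) ^ 2 ∂P = ∫ ω, (Z ω - Yt ω) ^ 2 ∂P :=
      integral_congr_ae (ae_of_all _ fun ω => by ring)
    rw [this]; exact h46
  -- the chain
  have hchain : ∫ ω, (Y₀ ω - Z ω) ^ 2 ∂P ≤ 3 * (ε₀ + 2 * (ε₀ + a) + b) :=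
    (integral_sq_sub_le_three P hY₀m hY₀'m hYtm hZm hY₀1 hY₀'1 hYt1 hZ1).trans (by nlinarith [h47, hmin, h46'])
  calc P.real ({ω | 1 / 2 < Z ω} ∆ E) ≤ 4 * ∫ ω, (Y₀ ω - Z ω) ^ 2 ∂P :=
        measureReal_symmDiff_setOf_lt_le P hE hZm hZ1
    _ ≤ 4 * (3 * (ε₀ + 2 * (ε₀ + a) + b)) := by nlinarith [hchain]
    _ = 12 * (3 * ε₀ + 2 * a + b) := by ring

end Final

end Literature.Probability.Percolation

end
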